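import Literature.Probability.Percolation.Z2SquareCycles
import HarnessLib

/-!
# The edge boundary of a connected set with connected complement is dual-connected (`ℤ²`)

Topic `Literature/Probability/Percolation` (planar duality toolkit); PROOFS ONLY (no definition, no
named fact).  The Whitney-type duality statement behind "clusters are bounded by dual circuits /
separated by dual paths" (H. Kesten, *Percolation theory for mathematicians* (1982), §2.2–2.3;
G. Grimmett, *Percolation* (1999), §11.2), in the Jordan-free form of Á. Timár,
*Boundary-connectivity via graph theory*, Proc. AMS 141 (2013), Thm. 3 / Friedli–Velenik 2017,
App. B, Lemma B.83: the tree's abstract lemma `exists_generator_crossing_both`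
(`CycleSpaceSeparators.lean`) fed with `generatesCycles_zdGraph_two` (`Z2SquareCycles.lean`:
the unit squares generate the cycle space of `ℤ²`).

For a finite set `A ⊂ ℤ²` of sites such that both `A` and `ℤ² ∖ A` are connected in the square
lattice, and the set `∂A` of lattice edges with exactly one endpoint in `A`:

* `exists_square_meeting_both` — every 2-partition of `∂A` into non-empty parts is met on both
  sides by the boundary of a single unit square;
* `boundary_squareChain` — hence any two edges of `∂A` are joined by a chain of edges of `∂A` in
  which consecutive edges bound a common unit square;
* `exists_faceWalk_boundary` — **dual connectivity**: for any two edges `e, e'` of `∂A` there is a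
  walk of faces (lower-left corners) from a face of `e` to a face of `e'` each step of which
  crosses an edge of `∂A` (the dual edges of `∂A` form a connected subgraph of the dual lattice).

## References

* Á. Timár, *Boundary-connectivity via graph theory*, Proc. AMS 141 (2013) 475–480, Lemma 1,
  Thm. 3 [Timar2013].
* S. Friedli, Y. Velenik, *Statistical Mechanics of Lattice Systems* (2017), App. B.15,
  Lemma B.83 [FriedliVelenik2017].
* H. Kesten, *Percolation theory for mathematicians* (1982), §2.2–2.3 (Whitney duality for
  clusters of `ℤ²`) [KestenPTM1982].
* G. Grimmett, *Percolation*, 2nd ed. (1999), §11.2 [Grimmett1999].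
-/

noncomputable section

open Finset SimpleGraph Relation
open Literature.Combinatorics.SimpleGraph.CycleSpace

namespace Literature.Probability.Percolation

open LatticeModels

variable {A : Finset (Site 2)}

/-- **Timár–Friedli–Velenik for the square lattice**: if `A` and its complement are connected,
every 2-partition of the edge boundary `∂A` into non-empty parts is met on both sides by the
boundary of one unit square. [cite: Timar2013, Lemma 1 and Thm. 3] -/
theorem exists_square_meeting_both
    (hA : ∀ a ∈ A, ∀ a' ∈ A, ∃ p : (zdGraph 2).Walk a a', ∀ w ∈ p.support, w ∈ A)
    (hAc : ∀ b ∉ A, ∀ b' ∉ A, ∃ p : (zdGraph 2).Walk b b', ∀ w ∈ p.support, w ∉ A)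
    {E₁ E₂ : Finset (Sym2 (Site 2))} (hE : ∀ e, e ∈ E₁ ∨ e ∈ E₂ ↔ e ∈ (zdGraph 2).edgeSet ∧ Crosses A e)
    (h₁ : E₁.Nonempty) (h₂ : E₂.Nonempty) (h₁₂ : Disjoint E₁ E₂) :
    ∃ g : Site 2, (∃ e ∈ squareEdges g, e ∈ E₁) ∧ ∃ e ∈ squareEdges g, e ∈ E₂ := by
  classical
  obtain ⟨C, ⟨g, rfl⟩, h1, h2⟩ := exists_generator_crossing_both generatesCycles_zdGraph_two squares_isEvenEdgeSet
    squares_subset_edgeSet hA hAc hE h₁ h₂ h₁₂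
  exact ⟨g, h1, h2⟩

/-- Two edges bound a common unit square. [folklore] -/
def OnCommonSquare (e e' : Sym2 (Site 2)) : Prop := ∃ g : Site 2, e ∈ squareEdges g ∧ e' ∈ squareEdges g

/-- **Square-chains in the boundary**: if `A` and its complement are connected, any two edges of
`∂A` are joined by a chain of edges of `∂A`, consecutive ones bounding a common unit square.
[cite: Timar2013, Thm. 3 (proof)] -/
theorem boundary_squareChain
    (hA : ∀ a ∈ A, ∀ a' ∈ A, ∃ p : (zdGraph 2).Walk a a', ∀ w ∈ p.support, w ∈ A)
    (hAc : ∀ b ∉ A, ∀ b' ∉ A, ∃ p : (zdGraph 2).Walk b b', ∀ w ∈ p.support, w ∉ A)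
    {e e' : Sym2 (Site 2)} (he : e ∈ (zdGraph 2).edgeSet ∧ Crosses A e) (he' : e' ∈ (zdGraph 2).edgeSet ∧ Crosses A e') :
    ReflTransGen (fun x y => OnCommonSquare x y ∧ (x ∈ (zdGraph 2).edgeSet ∧ Crosses A x) ∧
      (y ∈ (zdGraph 2).edgeSet ∧ Crosses A y)) e e' := by
  classical
  -- the boundary as a finset: edges of `A.sym2 ∪ …`; we use the finite set of lattice edges meeting `A`
  set R : Sym2 (Site 2) → Sym2 (Site 2) → Prop := fun x y => OnCommonSquare x y ∧
    (x ∈ (zdGraph 2).edgeSet ∧ Crosses A x) ∧ (y ∈ (zdGraph 2).edgeSet ∧ Crosses A y) with hR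
  -- a finite superset of the boundary: pairs `{a, a ± e_i}`, `a ∈ A`
  set B : Finset (Sym2 (Site 2)) := (A.biUnion fun a => ({s(a, a + Pi.single 0 1), s(a, a + Pi.single 1 1),
    s(a, a - Pi.single 0 1), s(a, a - Pi.single 1 1)} : Finset (Sym2 (Site 2)))) with hB
  have hbd : ∀ x : Sym2 (Site 2), x ∈ (zdGraph 2).edgeSet ∧ Crosses A x → x ∈ B := by
    intro x hx
    induction x using Sym2.ind with
    | h u v =>
      rw [crosses_mk] at hx
      rw [hB, Finset.mem_biUnion]
      have hadj : (zdGraph 2).Adj u v := hx.1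
      -- `v = u ± e_i`
      have hv : v = u + Pi.single 0 1 ∨ v = u + Pi.single 1 1 ∨ v = u - Pi.single 0 1 ∨ v = u - Pi.single 1 1 := by
        rcases stepKind_of_adj hadj with ⟨h0, h1⟩ | ⟨h0, h1⟩ | ⟨h1, h0⟩ | ⟨h1, h0⟩
        · left; rw [Site.eq_iff_two]; simp; omega
        · right; right; left; rw [Site.eq_iff_two]; simp; omega
        · right; left; rw [Site.eq_iff_two]; simp; omega
        · right; right; right; rw [Site.eq_iff_two]; simp; omega
      have hu : u = v + Pi.single 0 1 ∨ u = v + Pi.single 1 1 ∨ u = v - Pi.single 0 1 ∨ u = v - Pi.single 1 1 := by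
        rcases hv with h | h | h | h <;> rw [h]
        · right; right; left; abel
        · right; right; right; abel
        · left; abel
        · right; left; abel
      rcases hx.2 with ⟨huA, -⟩ | ⟨-, hvA⟩
      · refine ⟨u, huA, ?_⟩
        simp only [Finset.mem_insert, Finset.mem_singleton]
        rcases hv with h | h | h | h <;> simp [h]
      · refine ⟨v, hvA, ?_⟩
        simp only [Finset.mem_insert, Finset.mem_singleton]
        rw [Sym2.eq_swap]
        rcases hu with h | h | h | h <;> simp [h]
  -- the class of `e` and its complement inside the boundary
  set E₁ : Finset (Sym2 (Site 2)) := B.filter fun x => (x ∈ (zdGraph 2).edgeSet ∧ Crosses A x) ∧ ReflTransGen R e x with hE₁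
  set E₂ : Finset (Sym2 (Site 2)) := B.filter fun x => (x ∈ (zdGraph 2).edgeSet ∧ Crosses A x) ∧ ¬ ReflTransGen R e x with hE₂
  by_contra hcon
  have h₁ : E₁.Nonempty := ⟨e, Finset.mem_filter.2 ⟨hbd e he, he, ReflTransGen.refl⟩⟩
  have h₂ : E₂.Nonempty := ⟨e', Finset.mem_filter.2 ⟨hbd e' he', he', hcon⟩⟩
  have h₁₂ : Disjoint E₁ E₂ := by
    rw [Finset.disjoint_left]
    intro x hx hx'
    exact (Finset.mem_filter.1 hx').2.2 (Finset.mem_filter.1 hx).2.2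
  have hE : ∀ x, x ∈ E₁ ∨ x ∈ E₂ ↔ x ∈ (zdGraph 2).edgeSet ∧ Crosses A x := by
    intro x
    constructor
    · rintro (hx | hx)
      · exact (Finset.mem_filter.1 hx).2.1
      · exact (Finset.mem_filter.1 hx).2.1
    · intro hx
      by_cases h : ReflTransGen R e x
      · exact Or.inl (Finset.mem_filter.2 ⟨hbd x hx, hx, h⟩)
      · exact Or.inr (Finset.mem_filter.2 ⟨hbd x hx, hx, h⟩)
  obtain ⟨g, ⟨x, hxg, hx⟩, y, hyg, hy⟩ := exists_square_meeting_both hA hAc hE h₁ h₂ h₁₂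
  have hx' := Finset.mem_filter.1 hx
  have hy' := Finset.mem_filter.1 hy
  exact hy'.2.2 (hx'.2.2.tail ⟨⟨g, hxg, hyg⟩, hx'.2.1, hy'.2.1⟩)

/-- Two distinct edges bounding a common square have adjacent-or-equal… the faces: the square `g`
is a face of both. [folklore] -/
theorem mem_dualEdge_of_onCommonSquare {e e' : Sym2 (Site 2)} {g : Site 2} (he : e ∈ squareEdges g)
    (he' : e' ∈ squareEdges g) : g ∈ dualEdge e ∧ g ∈ dualEdge e' :=
  ⟨mem_dualEdge_of_mem_squareEdges he, mem_dualEdge_of_mem_squareEdges he'⟩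

/-- **Two faces of one lattice edge are adjacent, and the edge separates them.** [folklore] -/
theorem adj_and_sepEdge_eq_of_mem_dualEdge {e : Sym2 (Site 2)} (he : e ∈ (zdGraph 2).edgeSet) {g g' : Site 2}
    (hg : g ∈ dualEdge e) (hg' : g' ∈ dualEdge e) (hne : g ≠ g') : (zdGraph 2).Adj g g' ∧ sepEdge g g' = e := by
  have hdE : dualEdge e ∈ (zdGraph 2).edgeSet := dualEdge_mem_edgeSet_holds he
  -- `dualEdge e = {g, g'}`
  have heq : dualEdge e = s(g, g') := by
    generalize hq : dualEdge e = q at hg hg' hdE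
    induction q using Sym2.ind with
    | h u v =>
      rcases Sym2.mem_iff.1 hg with rfl | rfl <;> rcases Sym2.mem_iff.1 hg' with h | h
      · exact absurd h.symm hne
      · rw [h]
      · rw [h, Sym2.eq_swap]
      · exact absurd h.symm hne
  have hadj : (zdGraph 2).Adj g g' := by rw [heq] at hdE; exact hdE
  refine ⟨hadj, dualEdge_injOn_holds (sepEdge_mem_edgeSet hadj) he ?_⟩
  rw [dualEdge_sepEdge hadj, heq]

/-- **Dual connectivity of the boundary.**  If `A` and its complement are connected in `ℤ²`, then
for any two edges `e, e'` of the edge boundary `∂A` there is a walk of faces from a face of `e` to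
a face of `e'` every step of which crosses an edge of `∂A`. [cite: KestenPTM1982, §2.2–2.3 (Whitney duality); Timar2013, Thm. 3] -/
theorem exists_faceWalk_boundary
    (hA : ∀ a ∈ A, ∀ a' ∈ A, ∃ p : (zdGraph 2).Walk a a', ∀ w ∈ p.support, w ∈ A)
    (hAc : ∀ b ∉ A, ∀ b' ∉ A, ∃ p : (zdGraph 2).Walk b b', ∀ w ∈ p.support, w ∉ A)
    {e e' : Sym2 (Site 2)} (he : e ∈ (zdGraph 2).edgeSet ∧ Crosses A e) (he' : e' ∈ (zdGraph 2).edgeSet ∧ Crosses A e') :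
    ∃ (f f' : Site 2) (W : (zdGraph 2).Walk f f'), f ∈ dualEdge e ∧ f' ∈ dualEdge e' ∧
      ∀ d ∈ W.darts, sepEdge d.fst d.snd ∈ (zdGraph 2).edgeSet ∧ Crosses A (sepEdge d.fst d.snd) := by
  classical
  have hchain := boundary_squareChain hA hAc he he'
  clear he'
  -- induction along the chain, keeping a walk ending at a face of the current edge
  induction hchain with
  | refl =>
    -- a face of `e`
    generalize hq : dualEdge e = q
    induction q using Sym2.ind with
    | h u v => exact ⟨u, u, Walk.nil, Sym2.mem_mk_left _ _, Sym2.mem_mk_left _ _, by simp⟩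
  | tail _ hxy ih =>
    rename_i x y
    obtain ⟨f, f', W, hf, hf', hW⟩ := ih
    obtain ⟨⟨g, hxg, hyg⟩, hx, hy⟩ := hxy
    obtain ⟨hgx, hgy⟩ := mem_dualEdge_of_onCommonSquare hxg hyg
    -- extend `W` from `f'` (a face of `x`) to `g` (a face of `x` and of `y`) across `x` if needed
    by_cases hfg : f' = g
    · subst hfg
      exact ⟨f, f', W, hf, hgy, hW⟩
    · obtain ⟨hadj, hsep⟩ := adj_and_sepEdge_eq_of_mem_dualEdge hx.1 hf' hgx hfg
      refine ⟨f, g, W.concat hadj, hf, hgy, fun d hd => ?_⟩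
      rw [Walk.darts_concat, List.concat_eq_append, List.mem_append, List.mem_singleton] at hd
      rcases hd with hd | rfl
      · exact hW d hd
      · rw [show sepEdge (⟨(f', g), hadj⟩ : (zdGraph 2).Dart).fst (⟨(f', g), hadj⟩ : (zdGraph 2).Dart).snd = sepEdge f' g from rfl, hsep]
        exact hx

end Literature.Probability.Percolation

end
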